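import Summits.AtomisticToContinuum.Crystallization.Theorems.PricedLinkCensusStackingHingeRelaxedStarRigidityLocal

/-!
# Route `PricedLinkCensus`, crux `StackingHinge` (stmt-AtomisticToContinuum-14993), line `Sketch`:
# exact-star rigidity off the ideal ratio, III — the stretch along the layer normal; ideal stackings

Support file 3 of 4 for the registered stub `stub_relaxedStarRigidity` (pure geometry).

* The stretch `axialStretch g` commutes with every linear isometry `B` with `B e₃ = ± e₃`
  (`axialStretch_map_of_axial`), and with `g² a² = 3h²/2` (the inverse of the idealising stretch
  `h ↦ a√(2/3)`) maps vectors of norm `≤ a` to vectors of norm `≤ 5/4` on the parameter box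
  (`norm_axialStretch_le`: `max (a², 3h²/2) ≤ 25/16`), so that stars of the stretched set are seen
  inside the `5/4`-windows of the original one.
* Ideal Barlow stackings `barlowStacking a (a√(2/3)) s`: covering radius `< a` (Hales's
  `exists_dist_barlowPos_lt_two`, rescaled), the four shortest vectors `± u, ± v` of the layer
  through `0`, and the fact that only in-layer points of a reference star have their antipode in
  the star (`apply_two_eq_zero_of_neg_mem`, integer arithmetic) — used to see that the rotation
  produced by Hales's theorem fixes `± e₃`.

All `[folklore]`.
-/

noncomputable section

namespace Summit.AtomisticToContinuum.Crystallization.Theorems.PricedHcpWindowsRelaxedStarRigidity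

open Literature.MathematicalPhysics.StatisticalMechanics Literature.Geometry.DiscreteGeometry
open Summit.AtomisticToContinuum.Crystallization.Theorems.PalmUnimodularRigidity.LayeredLawsSelectHcp
open Summit.AtomisticToContinuum.Crystallization.Theorems.PricedHcpWindowsIdealStarRigidity
open Summit.AtomisticToContinuum.Crystallization.Theorems.PricedHcpWindowsHcpLocalExactRigid
open Summit.AtomisticToContinuum.Crystallization.Theorems.PricedHcpWindowsBarlowShellSupport

/-! ## The stretch: commutation and the window bound -/

/-- The stretch as `z + (g − 1) z₂ e₃`. [folklore] -/
theorem axialStretch_eq_add_smul (g : ℝ) (z : EuclideanSpace ℝ (Fin 3)) :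
    axialStretch g z = z + ((g - 1) * z 2) • layerAxis := by
  ext i; fin_cases i <;> simp [axialStretch, layerAxis]; ring

/-- **The stretch commutes with isometries fixing `± e₃`.** [folklore] -/
theorem axialStretch_map_of_axial {B : EuclideanSpace ℝ (Fin 3) ≃ₗᵢ[ℝ] EuclideanSpace ℝ (Fin 3)}
    (hB : B layerAxis = layerAxis ∨ B layerAxis = -layerAxis) (g : ℝ) (z : EuclideanSpace ℝ (Fin 3)) :
    axialStretch g (B z) = B (axialStretch g z) := by
  rw [axialStretch_eq_add_smul, axialStretch_eq_add_smul, map_add, map_smul]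
  rcases hB with h | h
  · rw [apply_two_of_map_layerAxis h, h]
  · rw [apply_two_of_map_layerAxis_neg h, h, smul_neg, ← neg_smul]
    congr 1
    ring_nf

/-- **The un-idealising stretch keeps stars inside the window**: on the parameter box, if
`g² a² = 3h²/2` then `‖z‖ ≤ a` implies `‖axialStretch g z‖ ≤ 5/4` (`max (a², 3h²/2) ≤ 25/16`).
[folklore] -/
theorem norm_axialStretch_le {a h : ℝ} (ha₁ : 189 / 200 ≤ a) (ha₂ : a ≤ 199 / 200) (hh₁ : 77 / 100 ≤ h)
    (hh₂ : h ≤ 163 / 200) {g : ℝ} (hg : g ^ 2 * a ^ 2 = 3 / 2 * h ^ 2)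
    {z : EuclideanSpace ℝ (Fin 3)} (hz : ‖z‖ ≤ a) : ‖axialStretch g z‖ ≤ 5 / 4 := by
  have hz2 : z 0 ^ 2 + z 1 ^ 2 + z 2 ^ 2 ≤ a ^ 2 := by
    rw [← norm_sq_eq_three]
    exact pow_le_pow_left₀ (norm_nonneg _) hz 2
  have hsq : ‖axialStretch g z‖ ^ 2 ≤ (5 / 4) ^ 2 := by
    rw [norm_axialStretch_sq]
    by_cases hg1 : g ^ 2 ≤ 1
    · nlinarith [sq_nonneg (z 2)]
    · have hg1 : 1 ≤ g ^ 2 := (lt_of_not_ge hg1).le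
      nlinarith [mul_nonneg (sub_nonneg.2 hg1) (add_nonneg (sq_nonneg (z 0)) (sq_nonneg (z 1))),
        mul_nonneg (sq_nonneg g) (sub_nonneg.2 hz2)]
  exact le_of_pow_le_pow_left₀ two_ne_zero (by norm_num) hsq

/-! ## The ideal Barlow stackings: covering radius and the layer through `0` -/

/-- **Covering radius `< a`**: every point of `ℝ³` is at distance `< a` from the ideal stacking
`barlowStacking a (a√(2/3)) s` (Hales's `exists_dist_barlowPos_lt_two` at scale `2`, rescaled by
`a/2`). [folklore] -/
theorem exists_mem_barlowStacking_dist_lt {a : ℝ} (ha : 0 < a) (s : ℤ → ℤ)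
    (p : EuclideanSpace ℝ (Fin 3)) :
    ∃ z ∈ barlowStacking a (a * Real.sqrt (2 / 3)) s, dist p z < a := by
  obtain ⟨k, i, j, hd⟩ := exists_dist_barlowPos_lt_two s ((2 / a) • p)
  have e : barlowPos a (a * Real.sqrt (2 / 3)) s k i j =
      (a / 2) • barlowPos 2 layerSpacing s k i j := by
    rw [barlowPos_eq_smul a, show layerSpacing = 2 * Real.sqrt (2 / 3) from rfl,
      barlowPos_eq_smul 2, smul_smul, div_mul_cancel₀ a two_ne_zero]
  refine ⟨barlowPos a (a * Real.sqrt (2 / 3)) s k i j, barlowPos_mem _ _ _, ?_⟩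
  have hp : (a / 2) • ((2 / a) • p) = p := by
    rw [smul_smul, show a / 2 * (2 / a) = 1 by field_simp, one_smul]
  calc dist p (barlowPos a (a * Real.sqrt (2 / 3)) s k i j)
      = dist ((a / 2) • ((2 / a) • p)) ((a / 2) • barlowPos 2 layerSpacing s k i j) := by
        rw [hp, e]
    _ = ‖a / 2‖ * dist ((2 / a) • p) (barlowPos 2 layerSpacing s k i j) := dist_smul₀ _ _ _
    _ < a / 2 * 2 := by
        rw [Real.norm_of_nonneg (by positivity)]
        exact mul_lt_mul_of_pos_left hd (by positivity)
    _ = a := by ring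

/-- **The four shortest vectors `± u, ± v` of the layer through `0`** of a Barlow stacking: they are
stacking points of norm `a`, lie in the plane `x₂ = 0`, come in antipodal pairs, and `u, v` are
independent. [folklore] -/
theorem layer_zero_vectors (a c : ℝ) (s : ℤ → ℤ) (ha : 0 ≤ a) :
    ‖barlowPos a c s 0 1 0‖ = a ∧ ‖barlowPos a c s 0 0 1‖ = a ∧
    barlowPos a c s 0 (-1) 0 = -barlowPos a c s 0 1 0 ∧
    barlowPos a c s 0 0 (-1) = -barlowPos a c s 0 0 1 ∧
    barlowPos a c s 0 1 0 2 = 0 ∧ barlowPos a c s 0 0 1 2 = 0 ∧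
    barlowPos a c s 0 1 0 0 * barlowPos a c s 0 0 1 1 -
      barlowPos a c s 0 1 0 1 * barlowPos a c s 0 0 1 0 = a ^ 2 * √3 / 2 := by
  have h3 : (√3 : ℝ) ^ 2 = 3 := Real.sq_sqrt (by norm_num)
  refine ⟨?_, ?_, ?_, ?_, ?_, ?_, ?_⟩
  · have h2 : ‖barlowPos a c s 0 1 0‖ ^ 2 = a ^ 2 := by
      rw [norm_sq_eq_three, barlowPos_apply_zero, barlowPos_apply_one, barlowPos_apply_two]
      simp
    exact (pow_left_inj₀ (norm_nonneg _) ha two_ne_zero).1 h2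
  · have h2 : ‖barlowPos a c s 0 0 1‖ ^ 2 = a ^ 2 := by
      rw [norm_sq_eq_three, barlowPos_apply_zero, barlowPos_apply_one, barlowPos_apply_two]
      simp
      linear_combination (a ^ 2 / 4) * h3
    exact (pow_left_inj₀ (norm_nonneg _) ha two_ne_zero).1 h2
  · ext l
    fin_cases l <;> simp [barlowPos_apply_zero, barlowPos_apply_one, barlowPos_apply_two]
  · ext l
    fin_cases l <;> simp [barlowPos_apply_zero, barlowPos_apply_one, barlowPos_apply_two]
    ring
  · rw [barlowPos_apply_two]; simp
  · rw [barlowPos_apply_two]; simp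
  · rw [barlowPos_apply_zero, barlowPos_apply_one, barlowPos_apply_zero, barlowPos_apply_one]
    simp
    ring

/-- **Only in-layer points of a reference star have their antipode in the star** (`a, c ≠ 0`): the
two labels would have opposite integer coordinates, which forces layer `0` (`starIdx_facts`).
[folklore] -/
theorem apply_two_eq_zero_of_neg_mem {a c : ℝ} (ha : a ≠ 0) (hc : c ≠ 0)
    {y : EuclideanSpace ℝ (Fin 3)} (hy : y ∈ (refStar a c : Set (EuclideanSpace ℝ (Fin 3))))
    (hny : -y ∈ (refStar a c : Set (EuclideanSpace ℝ (Fin 3)))) : y 2 = 0 := by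
  obtain ⟨v, hv, rfl⟩ := mem_coe_refStar_iff.1 hy
  obtain ⟨w, hw, hwe⟩ := mem_coe_refStar_iff.1 hny
  have e0 := congrArg (fun z : EuclideanSpace ℝ (Fin 3) => z 0) hwe
  have e1 := congrArg (fun z : EuclideanSpace ℝ (Fin 3) => z 1) hwe
  have e2 := congrArg (fun z : EuclideanSpace ℝ (Fin 3) => z 2) hwe
  simp only [PiLp.neg_apply] at e0 e1 e2
  rw [hcpSite_eq_siteVec, hcpSite_eq_siteVec] at e0 e1 e2
  obtain ⟨v0, v1, v2⟩ := siteVec_apply a c (siteInt v)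
  obtain ⟨w0, w1, w2⟩ := siteVec_apply a c (siteInt w)
  rw [v0, w0] at e0
  rw [v1, w1] at e1
  rw [v2, w2] at e2
  have h3 : (√3 : ℝ) ≠ 0 := by positivity
  have f0 : ((siteInt v).1 : ℝ) + (siteInt w).1 = 0 := by
    have : a / 2 * (((siteInt v).1 : ℝ) + (siteInt w).1) = 0 := by linear_combination e0
    exact (mul_eq_zero.1 this).resolve_left (by positivity)
  have f1 : ((siteInt v).2.1 : ℝ) + (siteInt w).2.1 = 0 := by
    have : a * √3 / 6 * (((siteInt v).2.1 : ℝ) + (siteInt w).2.1) = 0 := by linear_combination e1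
    exact (mul_eq_zero.1 this).resolve_left (by positivity)
  have f2 : ((siteInt v).2.2 : ℝ) + (siteInt w).2.2 = 0 := by
    have : c * (((siteInt v).2.2 : ℝ) + (siteInt w).2.2) = 0 := by linear_combination e2
    exact (mul_eq_zero.1 this).resolve_left hc
  have i0 : (siteInt v).1 + (siteInt w).1 = 0 := by exact_mod_cast f0
  have i1 : (siteInt v).2.1 + (siteInt w).2.1 = 0 := by exact_mod_cast f1
  have i2 : (siteInt v).2.2 + (siteInt w).2.2 = 0 := by exact_mod_cast f2
  have hsum : siteInt v + siteInt w = 0 := Prod.ext i0 (Prod.ext i1 i2)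
  rw [hcpSite_apply_two, starIdx_facts.2.1 v hv w hw hsum]
  simp

/-! ## Registered sub-goal -/

/-- **Registered sub-goal `stub_idealBarlowCovering` of stmt-AtomisticToContinuum-14993 (anchor of this
support file): the covering radius of an ideal Barlow stacking is `< a`** — every point of `ℝ³`
is at distance `< a` from `barlowStacking a (a√(2/3)) s`, for every `a > 0` and every word `s`
(Hales's `exists_dist_barlowPos_lt_two`, rescaled). [folklore] -/
theorem stub_idealBarlowCovering : ∀ a : ℝ, 0 < a → ∀ s : ℤ → ℤ, ∀ p : EuclideanSpace ℝ (Fin 3), ∃ z ∈ Literature.MathematicalPhysics.StatisticalMechanics.barlowStacking a (a * Real.sqrt (2 / 3)) s, dist p z < a := by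
  intro a ha s p
  exact exists_mem_barlowStacking_dist_lt ha s p

end Summit.AtomisticToContinuum.Crystallization.Theorems.PricedHcpWindowsRelaxedStarRigidity

end
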